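import Mathlib

/-!
# The camp is the genus character `χ₋₃` (ENGINE B, pub-hlocus abs-2 g50) — helper anchor

certified instances and evidence bearing on the general Hodge conjecture; no claim.

Finite core of DERIVATIONS_engineB §68.9.  At the prime 3 the definite quaternion algebra `B = (-1,-3)_ℚ` is
`ℚ₉ ⊕ ℚ₉·π` with `ℚ₉ = ℚ₃(i)` unramified and `π = j`, `π c π⁻¹ = c̄`.  An optimal embedding vector
`μ = x i + (y + w i) π` of a `ζ₃`-type discriminant has `π`-component `c = y + w i` with `y² + w² ≡ 1 (mod 3)`,
so `c mod 3 ∈ 𝔽₉ˣ` is `±1` (REAL camp, `3 ∣ w`) or `±i` (IMAG camp, `3 ∣ y`).  Conjugation by `α ∈ O_B` with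
`3 ∤ Nrd α` multiplies `c` by `α₀/ᾱ₀ = α₀² / N(α₀)` (`α₀ = α mod π`), hence the camp flips iff `N(α₀) = Nrd α mod 3 = 2`,
i.e. `camp(αμα⁻¹) = χ₋₃(Nrd α)·camp(μ)`; with the simply transitive class-group action the two camps are the cosets of
the kernel of the genus character `χ₋₃`, so `n_IMAG = n_REAL = h/2`.  Below, `𝔽₉ = 𝔽₃[i]` is modelled on pairs
`(a, b) ↦ a + b i` over `ZMod 3` and every statement is closed by `decide`.  Registered-style check
(genus_camp.py, exact quaternion arithmetic, |D| ≤ 400, Nrd α ≤ 11): 79 848 / 79 848 conjugations, 0 violations.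
-/

set_option linter.dupNamespace false

namespace Summit.HodgeConjecture.HodgeConjecture.HodgeLocus.Census.GenusCampB

/-- Multiplication in `𝔽₉ = 𝔽₃[i]`, `i² = -1`, on coordinate pairs. -/
def mul9 (p q : ZMod 3 × ZMod 3) : ZMod 3 × ZMod 3 :=
  (p.1 * q.1 - p.2 * q.2, p.1 * q.2 + p.2 * q.1)

/-- The norm `N : 𝔽₉ → 𝔽₃`, `N(a + b i) = a² + b²` (`= Nrd mod 3` on `3`-units of `O_B`). -/
def norm9 (p : ZMod 3 × ZMod 3) : ZMod 3 := p.1 * p.1 + p.2 * p.2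

/-- Frobenius = complex conjugation `a + b i ↦ a - b i` (`= conjugation by π`). -/
def frob (p : ZMod 3 × ZMod 3) : ZMod 3 × ZMod 3 := (p.1, -p.2)

/-- Camp dichotomy for `ζ₃`-type `D` (`y² + w² ≡ d ≡ 1`): exactly one of `y`, `w` vanishes mod 3. -/
theorem camp_dichotomy : ∀ c : ZMod 3 × ZMod 3, norm9 c = 1 → (c.1 = 0 ∧ c.2 ≠ 0) ∨ (c.1 ≠ 0 ∧ c.2 = 0) := by
  decide

/-- No camps for `√3`-type `D` (`y² + w² ≡ 2`): neither coordinate vanishes. -/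
theorem no_camp_sqrt3 : ∀ c : ZMod 3 × ZMod 3, norm9 c = 2 → c.1 ≠ 0 ∧ c.2 ≠ 0 := by decide

/-- `N` is multiplicative and Frobenius-invariant; `α₀ · ᾱ₀ = N(α₀)`. -/
theorem norm9_mul : ∀ p q : ZMod 3 × ZMod 3, norm9 (mul9 p q) = norm9 p * norm9 q := by decide

/-- `α₀ · ᾱ₀ = (N(α₀), 0)`. -/
theorem mul_frob : ∀ p : ZMod 3 × ZMod 3, mul9 p (frob p) = (norm9 p, 0) := by decide

/-- The conjugation factor `u = α₀ / ᾱ₀`: for a unit `α₀`, `u · ᾱ₀ = α₀` has the unique solution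
`u = α₀² · N(α₀)⁻¹`, and `N⁻¹ = N` on `𝔽₃ˣ = {1, 2}`. -/
def u (α : ZMod 3 × ZMod 3) : ZMod 3 × ZMod 3 := mul9 (mul9 α α) (norm9 α, 0)

/-- `u` is the quotient: `u(α₀) · ᾱ₀ = α₀` for every unit `α₀`. -/
theorem u_spec : ∀ α : ZMod 3 × ZMod 3, norm9 α ≠ 0 → mul9 (u α) (frob α) = α := by decide

/-- `u(α₀)` is `± 1` iff `N(α₀) = 1` and `± i` iff `N(α₀) = 2` (squares vs non-squares of `𝔽₉ˣ`). -/
theorem u_cases : ∀ α : ZMod 3 × ZMod 3, norm9 α ≠ 0 →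
    ((u α = (1, 0) ∨ u α = (-1, 0)) ↔ norm9 α = 1) ∧ ((u α = (0, 1) ∨ u α = (0, -1)) ↔ norm9 α = 2) := by
  decide

/-- CAMP CHARACTER LAW (IMAG camp = first coordinate `y ≡ 0`, i.e. the `π`-component is `± i`; REAL = `± 1`):
for a unit `α₀` and a camp vector `c` (`N c = 1`), the conjugate `u(α₀)·c` is again a camp vector and it is IMAG
exactly when `c` is REAL iff `N(α₀) = 2` — `camp(αμα⁻¹) = χ₋₃(Nrd α) · camp(μ)`. -/
theorem camp_flip_iff : ∀ α c : ZMod 3 × ZMod 3, norm9 α ≠ 0 → norm9 c = 1 →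
    norm9 (mul9 (u α) c) = 1 ∧ (((mul9 (u α) c).1 = 0 ↔ c.1 ≠ 0) ↔ norm9 α = 2) := by
  decide

/-- The twist `σ` (conjugation by `π`, `c ↦ c̄`) and the units (`N = 1`) preserve camps. -/
theorem frob_preserves : ∀ c : ZMod 3 × ZMod 3, norm9 c = 1 → ((frob c).1 = 0 ↔ c.1 = 0) := by decide

/-- `χ₋₃` on reduced norms: `Nrd mod 3 = 2` iff `(n / 3) = -1`; sample values of the registered check
(n = 2, 5, 8, 11 flip; n = 4, 7, 10 do not). -/
theorem chi_values : (2 : ZMod 3) = 2 ∧ (5 : ZMod 3) = 2 ∧ (8 : ZMod 3) = 2 ∧ (11 : ZMod 3) = 2 ∧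
    (4 : ZMod 3) = 1 ∧ (7 : ZMod 3) = 1 ∧ (10 : ZMod 3) = 1 := by decide

/-- Equipartition arithmetic: a non-trivial character to `{±1}` on a finite abelian group has kernel of index 2;
recorded here only as the counting identity used by the census bookkeeping (`h = n_I + n_R`, `n_I = n_R`). -/
theorem equipartition (h nI nR : ℕ) (hsum : h = nI + nR) (heq : nI = nR) : 2 * nI = h := by omega

end Summit.HodgeConjecture.HodgeConjecture.HodgeLocus.Census.GenusCampB
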